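import Literature.NumberTheory.EllipticCurves.EisensteinNewformLevelRaising
import Literature.NumberTheory.GaloisRepresentations.ArtinConductor
import HarnessLib

/-!
# Carayol 1986, Thm. (A) read on the local Euler factors: the inertia invariants of the Galois
# representation of a newform at a prime `ℓ ∣ N`, `ℓ ≠ p` (named fact)

Topic `Literature/NumberTheory/EllipticCurves`.  ONE named fact, no proofs.

For a newform `g ∈ S_k(Γ₁(N))`, `k ≥ 2`, an isomorphism `ι : ℚ̄_p ≃ ℂ`, an irreducible
`ρ : Γ_ℚ → GL₂(ℚ̄_p)` attached to `g` away from `Np` (`IsGaloisRepOfNewform1`), a prime `ℓ ∣ N`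
with `ℓ ≠ p` and a prime `𝔔` of `ℤ̄` above `ℓ`, the subspace of `ℚ̄_p²` fixed by the inertia group
`I_𝔔` is a LINE when `a_ℓ(g) ≠ 0` and is ZERO when `a_ℓ(g) = 0`.  This is Carayol's
Théorème (A) (local–global compatibility `σ_λ|_{W_ℓ} ≃ σ_λ(π_ℓ)`, Carayol 1986 (0.7) with (0.5),
(0.8), pp. 410–411; over `ℚ`: Langlands 1973 and Deligne) read on the degrees of the local
`L`-factors — "the conductor of the `λ`-adic representation of a newform is its level and its
`ℓ`-Euler factor is `(1 - a_ℓ ℓ^{-s})⁻¹`" (Edixhoven 1997, §1; Rohrlich 1997, §3.8 Thm. 5 in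
weight `2`): `dim V^{I_ℓ} = deg (1 - a_ℓ T)`.  No local Langlands correspondence, Frobenius or
duality convention enters this form.

The statement is, character for character, the hypothesis `H` of the ACCEPTED reduction
`Hida2000Thm326.inertia_of_level_of_finrank_inertiaInvariants`
(`EisensteinNewformLevelRaisingInertiaProofs.lean`, Part G, p93788), vendored as a named fact at
the request of promote event 3122828 (23 provefact seats on `Hida2000_thm326_inertia_of_level`;
librarian sweep g22, 2026-08-16): with it, `Hida2000_thm326_inertia_of_level` is ONE line
(`inertia_of_level_of_finrank_inertiaInvariants h`), i.e. proved modulo this single named input.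
Deliberately NOT here: Deligne's construction of `ρ_{g,ι}`, the Weil–Deligne / `rec` vocabulary
(`Automorphic.Varma2024.theorem12_trace_eq_and_precI` is the `GL_n` carrier), any proof.

## References

* H. Carayol, *Sur les représentations ℓ-adiques associées aux formes modulaires de Hilbert*,
  Ann. Sci. ÉNS (4) 19 (1986) 409–468, Thm. (A), (0.5), (0.7), (0.8) (pp. 410–411).
  [CarayolASENS1986]
* B. Edixhoven, *Serre's conjecture*, in: Modular Forms and Fermat's Last Theorem (1997), §1.
  [Edixhoven1997]
* D. Rohrlich, *Modular curves, Hecke correspondences, and L-functions*, in: Modular Forms and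
  Fermat's Last Theorem (1997), §3.8, Thm. 5. [Rohrlich1997]
* H. Hida, *Modular Forms and Galois Cohomology*, Cambridge Stud. Adv. Math. 69 (2000),
  Thm. 3.26 (3)(a), pp. 152–153. [Hida2000]
-/

noncomputable section

open scoped MatrixGroups Matrix NumberField ModularForm
open Matrix CongruenceSubgroup IsDedekindDomain Field NumberField

namespace Literature.NumberTheory.EllipticCurves

open Literature.NumberTheory.EllipticCurves.ModularForms
open Literature.NumberTheory.GaloisRepresentations

/-- **Carayol 1986, Thm. (A), inertia-invariants form.**  For every newform `g ∈ S_k(Γ₁(N))`,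
`k ≥ 2`, every `ι : ℚ̄_p ≃ ℂ`, every irreducible `ρ : Γ_ℚ → GL₂(ℚ̄_p)` attached to `g` away from
`Np`, every prime `ℓ ∣ N` with `ℓ ≠ p` and every prime `𝔔` of `ℤ̄` above `ℓ`: the inertia
invariants `(ℚ̄_p²)^{ρ(I_𝔔)}` have dimension `1` if `a_ℓ(g) ≠ 0` and are `0` if `a_ℓ(g) = 0`
(`dim V^{I_ℓ} = deg (1 - a_ℓ T)`: Carayol's local–global compatibility read on the `ℓ`-Euler
factor; over `ℚ` due to Langlands 1973 / Deligne, see Edixhoven 1997 §1, Rohrlich 1997 §3.8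
Thm. 5).  Verbatim the hypothesis `H` of
`Hida2000Thm326.inertia_of_level_of_finrank_inertiaInvariants`.
[cite: CarayolASENS1986, Thm. (A) (0.7) with (0.5), (0.8), pp. 410–411] -/
def Carayol1986_finrank_inertiaInvariants : Prop :=
  ∀ {N : ℕ} [NeZero N] {k : ℤ} (g : CuspForm (Gamma1 N) k), 2 ≤ k → IsNewform1 g →
    ∀ (p : ℕ) [Fact p.Prime] (ι : PadicAlgCl p ≃+* ℂ) (ρ : FramedGaloisRep ℚ (PadicAlgCl p) 2),
      IsGaloisRepOfNewform1 g
        ((ι.symm : ℂ →+* PadicAlgCl p).comp (algebraMap (coeffCharField g) ℂ)) {q | q ∣ N * p} ρ →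
      ρ.toGaloisRep.IsIrreducible →
    ∀ ℓ : ℕ, ℓ.Prime → ℓ ≠ p → ℓ ∣ N →
    ∀ w : HeightOneSpectrum (𝓞 ℚ), (ℓ : 𝓞 ℚ) ∈ w.asIdeal → ∀ 𝔔 ∈ w.primesAbove,
      ((UpperHalfPlane.qExpansion 1 ⇑g).coeff ℓ ≠ 0 →
          Module.finrank (PadicAlgCl p)
            (ρ.toGaloisRep.fixedSubmodule (𝔔.inertia (absoluteGaloisGroup ℚ))) = 1) ∧
      ((UpperHalfPlane.qExpansion 1 ⇑g).coeff ℓ = 0 →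
          ρ.toGaloisRep.fixedSubmodule (𝔔.inertia (absoluteGaloisGroup ℚ)) = ⊥)

end Literature.NumberTheory.EllipticCurves

end
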